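import Summits.AtomisticToContinuum.Crystallization.Theorems.OverbindingBudgetAffineRunCutChiralityTaylor
import Summits.AtomisticToContinuum.Crystallization.Theorems.OverbindingBudgetAffineRunCutAxialTaylor

/-!
# `OverbindingBudget` / crux `RobustDefectLimitWindows` (stmt-AtomisticToContinuum-31280) — «RunCut»: the chirality remainder summed over the coset

Support file (lens-4 g86, hand-in 3 part 0; memo `g86/memo/SW-G1.md` §9.10).  The pair skeleton `…RunCutChiralityTaylor.ljSq_pair_expansion`
summed over the offset coset at own scale `a` (`P(ij) = a²(Q₁(i,j) + 2/3)`), with ABSTRACT deformation data `t, t̄, u, ū : ℤ×ℤ → ℝ` subject only to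
`|t|, |t̄| ≤ τ·P` (`100τ ≤ 1`) and `|t² − 4u²|, |t̄² − 4ū²| ≤ σ·P²` — in the application `t = rᵀGr = 2u + |Br|²`, `u = rᵀEr`, `τ = (2α + βθ₀)θ₀`,
`σ = 4αβθ₀³ + β²θ₀⁴` — ★ `coset_remainder_le`: the remainder function
  `R(ij) = W(P+t) − W(P+t̄) − ½(P⁻⁴−P⁻⁷)(t−t̄) − (7P⁻⁸−4P⁻⁵)(u²−ū²)`
is summable and `|Σ' R| ≤ (31/3·τ³ + 7/2·σ)·a⁻¹²·J₁⁽⁶⁾(2/3) + (7/2·τ³ + 2σ)·a⁻⁶·J₁⁽³⁾(2/3)` (`J₁⁽ⁿ⁾(2/3) = layerSum 1 n (2/3)`, ≈ 3.0556 / 3.7032),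
i.e. the price line of memo §9.10 (1.4e-5 per TRIPLE column at `a = .848`, `θ₀ = 10⁻³`) as a theorem schema; what g87 supplies is only the pointwise
deformation inequalities from the `AffFramed` witness and the two box-sum enclosures.  [this file: 0 definitions, 2 theorems; imports
`…RunCutChiralityTaylor`, `…RunCutAxialTaylor`; standard axioms]
-/

namespace Summit.AtomisticToContinuum.Crystallization.Theorems.OverbindingBudgetAffineRunCutChiralityRemainder

open Literature.MathematicalPhysics.StatisticalMechanics.StackingSums
open Summit.AtomisticToContinuum.Crystallization.Theorems.OverbindingBudgetAffineRunCutForgone (ljSq)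
open Summit.AtomisticToContinuum.Crystallization.Theorems.OverbindingBudgetAffineRunCutChiralityTaylor
open Summit.AtomisticToContinuum.Crystallization.Theorems.OverbindingBudgetAffineRunCutAxialTaylor (abs_tsum_le_of_abs_le)

/-- **Pointwise remainder against layer terms.**  With `P = a²(Q₁+2/3)` (`0 < a`, `0 ≤ τ`), `|t|,|t̄| ≤ τP`, `100τ ≤ 1`, `|t²−4u²|, |t̄²−4ū²| ≤ σP²`:
`|R| ≤ (31/3·τ³ + 7/2·σ)·a⁻¹²·layerTerm 1 6 (2/3) ij + (7/2·τ³ + 2σ)·a⁻⁶·layerTerm 1 3 (2/3) ij`. [this file · kind: proof] -/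
theorem pointwise_remainder_le {a τ σ : ℝ} (ha : 0 < a) (hτ : 0 ≤ τ) (hτ1 : 100 * τ ≤ 1) (ij : ℤ × ℤ)
    {t t' u u' : ℝ}
    (ht : |t| ≤ τ * (a ^ 2 * (stackForm 1 ij.1 ij.2 + 2 / 3)))
    (ht' : |t'| ≤ τ * (a ^ 2 * (stackForm 1 ij.1 ij.2 + 2 / 3)))
    (hu : |t ^ 2 - 4 * u ^ 2| ≤ σ * (a ^ 2 * (stackForm 1 ij.1 ij.2 + 2 / 3)) ^ 2)
    (hu' : |t' ^ 2 - 4 * u' ^ 2| ≤ σ * (a ^ 2 * (stackForm 1 ij.1 ij.2 + 2 / 3)) ^ 2) :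
    |ljSq (a ^ 2 * (stackForm 1 ij.1 ij.2 + 2 / 3) + t) - ljSq (a ^ 2 * (stackForm 1 ij.1 ij.2 + 2 / 3) + t')
        - 1 / 2 * (((a ^ 2 * (stackForm 1 ij.1 ij.2 + 2 / 3))⁻¹) ^ 4 - ((a ^ 2 * (stackForm 1 ij.1 ij.2 + 2 / 3))⁻¹) ^ 7) * (t - t')
        - (7 * ((a ^ 2 * (stackForm 1 ij.1 ij.2 + 2 / 3))⁻¹) ^ 8 - 4 * ((a ^ 2 * (stackForm 1 ij.1 ij.2 + 2 / 3))⁻¹) ^ 5)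
          * (u ^ 2 - u' ^ 2)|
      ≤ (31 / 3 * τ ^ 3 + 7 / 2 * σ) * (a⁻¹) ^ 12 * layerTerm 1 6 (2 / 3) ij
        + (7 / 2 * τ ^ 3 + 2 * σ) * (a⁻¹) ^ 6 * layerTerm 1 3 (2 / 3) ij := by
  set P : ℝ := a ^ 2 * (stackForm 1 ij.1 ij.2 + 2 / 3) with hPdef
  have hq : 0 < stackForm 1 ij.1 ij.2 + 2 / 3 := by linarith [stackForm_one_pos ij.1 ij.2]
  have hP : 0 < P := by positivity
  have h1 : 100 * |t| ≤ P := by nlinarith [abs_nonneg t]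
  have h2 : 100 * |t'| ≤ P := by nlinarith [abs_nonneg t']
  have key := ljSq_pair_expansion hP h1 h2 u u'
  have hτP : 0 ≤ τ * P := by positivity
  have c1 : |t| ^ 3 ≤ (τ * P) ^ 3 := pow_le_pow_left₀ (abs_nonneg t) ht 3
  have c2 : |t'| ^ 3 ≤ (τ * P) ^ 3 := pow_le_pow_left₀ (abs_nonneg t') ht' 3
  have eL6 : (a⁻¹) ^ 12 * layerTerm 1 6 (2 / 3) ij = (P⁻¹) ^ 6 := by
    rw [hPdef, mul_inv, mul_pow, ← inv_pow a 2, ← pow_mul]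
    simp only [layerTerm]
  have eL3 : (a⁻¹) ^ 6 * layerTerm 1 3 (2 / 3) ij = (P⁻¹) ^ 3 := by
    rw [hPdef, mul_inv, mul_pow, ← inv_pow a 2, ← pow_mul]
    simp only [layerTerm]
  have hA : 0 ≤ 31 / 6 * (P⁻¹) ^ 9 + 7 / 4 * (P⁻¹) ^ 6 := by positivity
  have hB : 0 ≤ 7 / 4 * (P⁻¹) ^ 8 + (P⁻¹) ^ 5 := by positivity
  calc _ ≤ (31 / 6 * (P⁻¹) ^ 9 + 7 / 4 * (P⁻¹) ^ 6) * (|t| ^ 3 + |t'| ^ 3)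
          + (7 / 4 * (P⁻¹) ^ 8 + (P⁻¹) ^ 5) * (|t ^ 2 - 4 * u ^ 2| + |t' ^ 2 - 4 * u' ^ 2|) := key
    _ ≤ (31 / 6 * (P⁻¹) ^ 9 + 7 / 4 * (P⁻¹) ^ 6) * ((τ * P) ^ 3 + (τ * P) ^ 3)
          + (7 / 4 * (P⁻¹) ^ 8 + (P⁻¹) ^ 5) * (σ * P ^ 2 + σ * P ^ 2) := by gcongr
    _ = (31 / 3 * τ ^ 3 + 7 / 2 * σ) * (P⁻¹) ^ 6 + (7 / 2 * τ ^ 3 + 2 * σ) * (P⁻¹) ^ 3 := by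
          field_simp
          ring
    _ = _ := by rw [← eL6, ← eL3]; ring

/-- ★ **The chirality remainder summed over the offset coset.**  Under the pointwise hypotheses of `pointwise_remainder_le` for every `ij`, the
remainder function is summable and `|Σ' R| ≤ (31/3·τ³ + 7/2·σ)·a⁻¹²·layerSum 1 6 (2/3) + (7/2·τ³ + 2σ)·a⁻⁶·layerSum 1 3 (2/3)`. [this file · kind: proof] -/
theorem coset_remainder_le {a τ σ : ℝ} (ha : 0 < a) (hτ : 0 ≤ τ) (hτ1 : 100 * τ ≤ 1)
    (t t' u u' : ℤ × ℤ → ℝ)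
    (ht : ∀ ij : ℤ × ℤ, |t ij| ≤ τ * (a ^ 2 * (stackForm 1 ij.1 ij.2 + 2 / 3)))
    (ht' : ∀ ij : ℤ × ℤ, |t' ij| ≤ τ * (a ^ 2 * (stackForm 1 ij.1 ij.2 + 2 / 3)))
    (hu : ∀ ij : ℤ × ℤ, |t ij ^ 2 - 4 * u ij ^ 2| ≤ σ * (a ^ 2 * (stackForm 1 ij.1 ij.2 + 2 / 3)) ^ 2)
    (hu' : ∀ ij : ℤ × ℤ, |t' ij ^ 2 - 4 * u' ij ^ 2| ≤ σ * (a ^ 2 * (stackForm 1 ij.1 ij.2 + 2 / 3)) ^ 2) :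
    (Summable fun ij : ℤ × ℤ =>
        ljSq (a ^ 2 * (stackForm 1 ij.1 ij.2 + 2 / 3) + t ij) - ljSq (a ^ 2 * (stackForm 1 ij.1 ij.2 + 2 / 3) + t' ij)
          - 1 / 2 * (((a ^ 2 * (stackForm 1 ij.1 ij.2 + 2 / 3))⁻¹) ^ 4 - ((a ^ 2 * (stackForm 1 ij.1 ij.2 + 2 / 3))⁻¹) ^ 7) * (t ij - t' ij)
          - (7 * ((a ^ 2 * (stackForm 1 ij.1 ij.2 + 2 / 3))⁻¹) ^ 8 - 4 * ((a ^ 2 * (stackForm 1 ij.1 ij.2 + 2 / 3))⁻¹) ^ 5)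
            * (u ij ^ 2 - u' ij ^ 2))
      ∧ |∑' ij : ℤ × ℤ,
          (ljSq (a ^ 2 * (stackForm 1 ij.1 ij.2 + 2 / 3) + t ij) - ljSq (a ^ 2 * (stackForm 1 ij.1 ij.2 + 2 / 3) + t' ij)
            - 1 / 2 * (((a ^ 2 * (stackForm 1 ij.1 ij.2 + 2 / 3))⁻¹) ^ 4 - ((a ^ 2 * (stackForm 1 ij.1 ij.2 + 2 / 3))⁻¹) ^ 7) * (t ij - t' ij)
            - (7 * ((a ^ 2 * (stackForm 1 ij.1 ij.2 + 2 / 3))⁻¹) ^ 8 - 4 * ((a ^ 2 * (stackForm 1 ij.1 ij.2 + 2 / 3))⁻¹) ^ 5)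
              * (u ij ^ 2 - u' ij ^ 2))|
        ≤ (31 / 3 * τ ^ 3 + 7 / 2 * σ) * (a⁻¹) ^ 12 * layerSum 1 6 (2 / 3)
          + (7 / 2 * τ ^ 3 + 2 * σ) * (a⁻¹) ^ 6 * layerSum 1 3 (2 / 3) := by
  have h23 : (0 : ℝ) ≤ 2 / 3 := by norm_num
  have hg : Summable fun ij : ℤ × ℤ => (31 / 3 * τ ^ 3 + 7 / 2 * σ) * (a⁻¹) ^ 12 * layerTerm 1 6 (2 / 3) ij
      + (7 / 2 * τ ^ 3 + 2 * σ) * (a⁻¹) ^ 6 * layerTerm 1 3 (2 / 3) ij :=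
    ((layerTerm_summable le_rfl h23 (by norm_num)).mul_left _).add ((layerTerm_summable le_rfl h23 (by norm_num)).mul_left _)
  have hpt := fun ij => pointwise_remainder_le ha hτ hτ1 ij (ht ij) (ht' ij) (hu ij) (hu' ij)
  have hf : Summable fun ij : ℤ × ℤ =>
      ljSq (a ^ 2 * (stackForm 1 ij.1 ij.2 + 2 / 3) + t ij) - ljSq (a ^ 2 * (stackForm 1 ij.1 ij.2 + 2 / 3) + t' ij)
        - 1 / 2 * (((a ^ 2 * (stackForm 1 ij.1 ij.2 + 2 / 3))⁻¹) ^ 4 - ((a ^ 2 * (stackForm 1 ij.1 ij.2 + 2 / 3))⁻¹) ^ 7) * (t ij - t' ij)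
        - (7 * ((a ^ 2 * (stackForm 1 ij.1 ij.2 + 2 / 3))⁻¹) ^ 8 - 4 * ((a ^ 2 * (stackForm 1 ij.1 ij.2 + 2 / 3))⁻¹) ^ 5)
          * (u ij ^ 2 - u' ij ^ 2) := by
    refine Summable.of_norm_bounded hg fun ij => ?_
    rw [Real.norm_eq_abs]
    exact hpt ij
  refine ⟨hf, ?_⟩
  have h := abs_tsum_le_of_abs_le (c := 1) hf hg (fun ij => by rw [one_mul]; exact hpt ij)
  rw [one_mul, ((layerTerm_summable le_rfl h23 (by norm_num)).mul_left _).tsum_add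
    ((layerTerm_summable le_rfl h23 (by norm_num)).mul_left _), tsum_mul_left, tsum_mul_left] at h
  unfold layerSum
  exact h

end Summit.AtomisticToContinuum.Crystallization.Theorems.OverbindingBudgetAffineRunCutChiralityRemainder
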